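import Summits.QuantumFields.YangMills.Theorems.TwistedTraceScaling.Negative.ValleyLinkProxExponent
import Summits.QuantumFields.YangMills.Theorems.LuscherReductionTwistedTraceScalingValleyLinkProx
import HarnessLib

/-!
# R12c (crux `TwistedTraceScaling`, stmt-QuantumFields-20203): the exponent thresholds of lane A's proximity sub-targets are EXACT —
# `ValleyLinkProxAt L (β^{−p}) (β^{−q}) ↔ 4p < q` (every `L ≥ 1`) and `ValleyGeomAt L (β^{−p}) (β^{−q}) ↔ 4p < q` (`L ≥ 2`)

Standing disprover `ym-cdisprove-20203-1` (gen 11).  Lane A DISCHARGED the proximity sub-targets of the C3 skeleton above the line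
(`…TwistedTraceScalingValleyLinkProx`, p587399: `exists_step_decomp` — every `U` is `W·(g·V_θ)` with `‖W_e − 1‖_F ≤ combRadius L S(U) ≍ S^{1/4}` — and
`valleyLinkProxAt_pow` / `valleyGeomAt_pow : 0 < p → 4p < q → …`); the disprover's R11 (`valleyGeom_pow_false`, `L ≥ 2`) and R12 (`valleyLinkProx_pow_false`,
every `L ≥ 1`) refute them on and below it.  This file records the two `iff`s, so that the registry / LEAD can cite ONE statement per sub-target:
* ★ `valleyLinkProxAt_pow_iff (L) [NeZero L] (hp : 0 < p) (hq : 0 < q) : ValleyLinkProxAt L (powScale p) (powScale q) ↔ 4 * p < q`;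
* ★ `valleyGeomAt_pow_iff (L) [NeZero L] (hL : 2 ≤ L) (hp : 0 < p) (hq : 0 < q) : ValleyGeomAt L (powScale p) (powScale q) ↔ 4 * p < q`.
READING (COARSE-DESIGN §16): the `S^{1/4}` law of `exists_step_decomp` is therefore OPTIMAL in the exponent on the valley sets: at `q = 4p` the valley set is
`O_L(δ)`- but not `o(δ)`-link-close to the gauge-torons (R12 kills every `ε < 1/(8(4N+2√N+1))`, `N = √(4#P+1)`; lane A's comb radius gives a constant `≍ L²`),
and strictly below the line not even `O(δ)`-close (`…Negative.ValleyProximityBigO`).  What remains OPEN at `L = 1` is only the GEOM text for `q ≤ 4p`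
(R11's single-link test vectors need `L ≥ 2`; the LINK text is settled at every `L`).
HONEST FRAMING: fixed-lattice `SU(2)` geometry about typed sub-targets of a stub (S-BASE C3) of a child of the CONDITIONAL reduction route (femto rung R2b1);
`ValleyBOAt`, `InnerNoIntruderOneOrbitAt`, C3/C4 stay OPEN; not `¬TwistedTraceScaling`, not infinite volume, not a gap, not Clay.
Sorry-free, no new definition; axioms ⊆ {propext, Classical.choice, Quot.sound}.
-/

set_option autoImplicit false

noncomputable section

open Summit.QuantumFields.YangMills.Theorems.FemtoTransferGap
open Summit.QuantumFields.YangMills.Theorems.TwistedTraceScaling.Negative.R11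

namespace Summit.QuantumFields.YangMills.Theorems.TwistedTraceScaling.Negative.R12

/-- ★ **Exact threshold of the LINK-PROXIMITY sub-target** (every `L ≥ 1`): for `0 < p`, `0 < q`,
`ValleyLinkProxAt L (β^{−p}) (β^{−q}) ↔ 4p < q` — lane A's `valleyLinkProxAt_pow` above the line, R12's `valleyLinkProx_pow_false` on and below it.
[cite: Luscher1983, §2] -/
theorem valleyLinkProxAt_pow_iff (L : ℕ) [NeZero L] {p q : ℝ} (hp : 0 < p) (hq : 0 < q) :
    ValleyLinkProxAt L (powScale p) (powScale q) ↔ 4 * p < q :=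
  ⟨fun h => not_le.1 fun hqp => valleyLinkProx_pow_false L hp hq hqp h, fun hpq => valleyLinkProxAt_pow hp hpq⟩

/-- ★ **Exact threshold of the GEOMETRY sub-target** (`L ≥ 2`): for `0 < p`, `0 < q`,
`ValleyGeomAt L (β^{−p}) (β^{−q}) ↔ 4p < q` — lane A's `valleyGeomAt_pow` above the line, R11's `valleyGeom_pow_false` on and below it.
[cite: Luscher1983, §2–§3] -/
theorem valleyGeomAt_pow_iff (L : ℕ) [NeZero L] (hL : 2 ≤ L) {p q : ℝ} (hp : 0 < p) (hq : 0 < q) :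
    ValleyGeomAt L (powScale p) (powScale q) ↔ 4 * p < q :=
  ⟨fun h => not_le.1 fun hqp => valleyGeom_pow_false L hL hp hq hqp h, fun hpq => valleyGeomAt_pow hp hpq⟩

/-- At lane A's exponents of record `(p, q) = (1/16, 0.85)` both sub-targets hold (`4p = 1/4 < 0.85`), at `(1/8, 1/2)` both fail (`4p = 1/2`). -/
example (L : ℕ) [NeZero L] (hL : 2 ≤ L) :
    (ValleyLinkProxAt L (powScale (1 / 16)) (powScale 0.85) ∧ ValleyGeomAt L (powScale (1 / 16)) (powScale 0.85)) ∧
      ¬ ValleyLinkProxAt L (powScale (1 / 8)) (powScale (1 / 2)) ∧ ¬ ValleyGeomAt L (powScale (1 / 8)) (powScale (1 / 2)) :=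
  ⟨⟨(valleyLinkProxAt_pow_iff L (by norm_num) (by norm_num)).2 (by norm_num), (valleyGeomAt_pow_iff L hL (by norm_num) (by norm_num)).2 (by norm_num)⟩,
    fun h => absurd ((valleyLinkProxAt_pow_iff L (by norm_num) (by norm_num)).1 h) (by norm_num),
    fun h => absurd ((valleyGeomAt_pow_iff L hL (by norm_num) (by norm_num)).1 h) (by norm_num)⟩

end Summit.QuantumFields.YangMills.Theorems.TwistedTraceScaling.Negative.R12

end
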